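import Summits.HodgeConjecture.HodgeConjecture.Theorems.PadicSemiregularLiftHodgeAbelianVarietiesStubWeilSectorSuffices
import Literature.AlgebraicGeometry.HodgeTheory.LefschetzOneOneHolds
import HarnessLib

/-!
# `HodgeAbelianVarieties` (stmt-HodgeConjecture-1333) · the unconditional corners after the discharges of 2026-08-16

Item `stmt-HodgeConjecture-1333` of route `PadicSemiregularLift` is the Hodge conjecture for every
complex abelian variety,
`HodgeAbelianVarieties : ∀ A : AbelianVariety ℂ, HodgeConjectureFor A.dim A.X` — an open problem in
print beyond the divisor-generated / low-dimensional sectors. The tree recorded its settled corners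
CONDITIONALLY on the named facts `nonempty_hodgeModel` (Serre GAGA + de Rham + Hodge decomposition),
`lefschetzOneOne_rational` (Lefschetz `(1,1)`, Voisin I Thm. 11.30), `nonempty_hardLefschetzNFold`
(hard Lefschetz, Voisin I Thm. 6.25) and `hodgeClasses_algebraic_of_dim_le_three` (Voisin II, proof of
Prop. 10.26) — files `Theorems/HodgeAbelianVarieties/Negative/ExtremeCodimensions` and
`Theorems/PadicSemiregularLiftHodgeAbelianVarietiesStubWeilSectorSuffices`. All four facts are now
THEOREMS of the tree (`nonempty_hodgeModel_holds`, `lefschetzOneOne_rational_holds`,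
`nonempty_hardLefschetzNFold_holds`, `hodgeClasses_algebraic_of_dim_le_three_holds`, the last two
landed 2026-08-16), so the corners hold outright. This file records them hypothesis-free, for the
planners' census of what the crux still asks:

* (the crux IS its cycle part, anti-vacuity conjunct discharged: already
  `Theorems.hodgeAbelianVarieties_iff_cyclePart`, file `PadicSemiregularLiftAbelianAnchorAssemblyThreshold`);
* `hodgeConjectureFor_of_dim_le_three_holds` — **the crux holds for abelian varieties of dimension
  `≤ 3`** (curves, surfaces, threefolds), unconditionally;
* `hodgeAbelianVarieties_iff_deepMiddle_holds` — **the crux is equivalent to its deep-middle part**: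
  rational `(p,p)`-classes with `2 ≤ p`, `2p ≤ dim A` are algebraic; hence
  `hodgeAbelianVarieties_iff_four_le_dim_holds`: a counterexample lives on an abelian variety of
  dimension `≥ 4`, in codimension `2 ≤ p ≤ dim A / 2`;
* `divisorClassesSpan_le_algebraicClasses_holds`, `hodgeConjectureFor_of_divisorGenerated_holds` —
  **the divisor-generated sector** `Dᵖ ⊗ ℂ ⊆ Nᵖ H²ᵖ` (Mattuck / Tate / Tankeev–Ribet: whenever
  `Bᵖ(A) = Dᵖ(A)` for all `p`, the Hodge conjecture holds for `A`), unconditionally.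

What remains conditional in the tree: dimension `4`–`5` (Moonen–Zarhin 1999 + Markman 2025, print
facts `MoonenZarhin1999_hodgeClasses_abelian_dim_le_five_of_weilClassesFourfolds`,
`Markman2025_weilClasses_algebraic_abelianFourfold`), and dimension `≥ 6` (open in print: Weil classes
on non-split Weil-type abelian varieties).

## References

* [Deligne2000] P. Deligne, The Hodge conjecture, Clay Mathematics Institute (2000), §1.
* [VoisinHodgeI2002] C. Voisin, Hodge Theory and Complex Algebraic Geometry I (CUP 2002), Thm. 6.25,
  Thm. 11.30.
* [VoisinHodgeII2003] C. Voisin, Hodge Theory and Complex Algebraic Geometry II (CUP 2003), §10.2.3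
  proof of Prop. 10.26.
* [vanGeemen1994HodgeAV] B. van Geemen, An introduction to the Hodge conjecture for abelian varieties,
  LNM 1594 (1994), §2.4.
* [KerrPearlstein2011] M. Kerr, G. Pearlstein, An exponential history of functions with logarithmic
  growth, MSRI Publ. 58 (2011), §3.1.
-/

noncomputable section

-- summit-side namespace `Summit.HodgeConjecture.HodgeConjecture.…` (D-0017: `Summit.<Summit>.<Sub>`)
set_option linter.dupNamespace false

open CategoryTheory AlgebraicGeometry
open Literature.AlgebraicGeometry Literature.AlgebraicGeometry.HodgeTheory
  Literature.AlgebraicGeometry.Motives Literature.AlgebraicTopology.SingularHomology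
open Summit.HodgeConjecture.HodgeConjecture.Theses.PadicSemiregularLift
open Summit.HodgeConjecture.HodgeConjecture.Theorems.HodgeAbelianVarieties

namespace Summit.HodgeConjecture.HodgeConjecture.Theorems.HodgeAbelianVarieties.Unconditional

/-! ### Dimension `≤ 3`

(The crux is exactly its cycle part, unconditionally: `Theorems.hodgeAbelianVarieties_iff_cyclePart`,
file `PadicSemiregularLiftAbelianAnchorAssemblyThreshold`, which also records `dim A ≤ 1`.) -/

/-- **The Hodge conjecture holds for every complex abelian variety of dimension `≤ 3`**,
unconditionally: an abelian variety is smooth projective of dimension `A.dim`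
(`AbelianVariety.isSmoothProjective_holds`) and the Hodge conjecture holds for smooth projective curves,
surfaces and threefolds (`hodgeConjectureFor_of_dim_le_three_holds`: Lefschetz `(1,1)` and hard
Lefschetz `L : H² ≅ H⁴`, both theorems of the tree). [cite: VoisinHodgeII2003, §10.2.3 proof of Prop. 10.26]
[cite: VoisinHodgeI2002, Thm. 6.25 and Thm. 11.30] -/
theorem hodgeConjectureFor_of_dim_le_three_holds : ∀ A : AbelianVariety ℂ, A.dim ≤ 3 → HodgeConjectureFor A.dim A.X :=
  fun _ hd ↦ HodgeTheory.hodgeConjectureFor_of_dim_le_three_holds hd AbelianVariety.isSmoothProjective_holds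

/-- The registered partial `hodgeAbelianVarieties_dim_le_three` of `stub_weilSectorSuffices` with its
named-fact antecedent DISCHARGED (`hodgeClasses_algebraic_of_dim_le_three_holds`).
[cite: VoisinHodgeII2003, §10.2.3 proof of Prop. 10.26] -/
theorem hodgeAbelianVarieties_dim_le_three_discharged (A : AbelianVariety ℂ) (hd : A.dim ≤ 3) :
    HodgeConjectureFor A.dim A.X :=
  Cruxes.HodgeAbelianVarieties.EStepSecantInduction.Stubs.WeilSector.hodgeAbelianVarieties_dim_le_three
    hodgeClasses_algebraic_of_dim_le_three_holds A hd

/-! ### The deep middle -/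

/-- **The crux is equivalent to its deep-middle part**, unconditionally: `HodgeAbelianVarieties` holds
iff on every abelian variety `A` every rational `(p,p)`-class with `2 ≤ p` and `2p ≤ dim A` is algebraic
— `p = 0` and `p ≥ dim A` are harmless (`Negative.mem_algebraicClasses_of_dim_le`), `p = 1` is Lefschetz
`(1,1)` (`lefschetzOneOne_rational_holds`), and `2p > dim A` is reduced below the middle by hard
Lefschetz (`nonempty_hardLefschetzNFold_holds`). [cite: VoisinHodgeI2002, Thm. 6.25 and Thm. 11.30]
[cite: KerrPearlstein2011, §3.1] -/
theorem hodgeAbelianVarieties_iff_deepMiddle_holds : Summit.HodgeConjecture.HodgeConjecture.Theses.PadicSemiregularLift.HodgeAbelianVarieties ↔ ∀ (A : AbelianVariety ℂ) (p : ℕ), 2 ≤ p → 2 * p ≤ A.dim → ∀ c : singularCohomology ℂ ℂ (ComplexPoints A.X) (2 * p), IsRationalClass c → IsOfHodgeType A.dim A.X (2 * p) p p c → c ∈ algebraicClasses A.X p :=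
  Negative.hodgeAbelianVarieties_iff_deepMiddle (fun _ _ ↦ nonempty_hodgeModel_holds)
    lefschetzOneOne_rational_holds nonempty_hardLefschetzNFold_holds

/-- **A counterexample to the crux lives in dimension `≥ 4`**, unconditionally: `HodgeAbelianVarieties`
holds iff it holds — in its deep-middle form `2 ≤ p`, `2p ≤ dim A` — on abelian varieties of dimension
`≥ 4` (for `dim A ≤ 3` the deep middle is empty). [cite: VoisinHodgeII2003, §10.2.3 proof of Prop. 10.26]
[cite: KerrPearlstein2011, §3.1] -/
theorem hodgeAbelianVarieties_iff_four_le_dim_holds :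
    HodgeAbelianVarieties ↔
      ∀ A : AbelianVariety ℂ, 4 ≤ A.dim → ∀ p : ℕ, 2 ≤ p → 2 * p ≤ A.dim →
        ∀ c : singularCohomology ℂ ℂ (ComplexPoints A.X) (2 * p), IsRationalClass c →
          IsOfHodgeType A.dim A.X (2 * p) p p c → c ∈ algebraicClasses A.X p := by
  rw [hodgeAbelianVarieties_iff_deepMiddle_holds]
  exact ⟨fun h A _ p hp hpd c hc hpp ↦ h A p hp hpd c hc hpp,
    fun h A p hp hpd c hc hpp ↦ h A (by omega) p hp hpd c hc hpp⟩

/-- **The crux reduces to abelian varieties of dimension `≥ 4`** (statement-level form): the Hodge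
conjecture for all complex abelian varieties follows from the Hodge conjecture for those of dimension
`≥ 4`, the case `dim A ≤ 3` being a theorem. [cite: VoisinHodgeII2003, §10.2.3 proof of Prop. 10.26] -/
theorem hodgeAbelianVarieties_of_four_le_dim
    (h : ∀ A : AbelianVariety ℂ, 4 ≤ A.dim → HodgeConjectureFor A.dim A.X) : HodgeAbelianVarieties := by
  intro A
  rcases Nat.lt_or_ge A.dim 4 with hlt | hge
  · exact hodgeConjectureFor_of_dim_le_three_holds A (by omega)
  · exact h A hge

/-! ### The divisor-generated sector -/

/-- **`Dᵖ ⊗ ℂ ⊆ Nᵖ H²ᵖ` on every complex abelian variety**, unconditionally: the `ℂ`-span of the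
`p`-fold cup products of rational `(1,1)`-classes consists of algebraic classes (Lefschetz `(1,1)`,
now `lefschetzOneOne_rational_holds`, and the tree's theorem that cup product with a divisor class
preserves algebraicity on an abelian variety, `AbelianVariety.cupProduct_mem_algebraicClasses_one`).
[cite: vanGeemen1994HodgeAV, §2.4] -/
theorem divisorClassesSpan_le_algebraicClasses_holds (A : AbelianVariety ℂ) (p : ℕ) :
    Literature.Barriers.HodgeConjecture.divisorClassesSpan A.X A.dim p ≤ algebraicClasses A.X p :=
  Cruxes.HodgeAbelianVarieties.EStepSecantInduction.Stubs.WeilSector.divisorClassesSpan_le_algebraicClasses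
    lefschetzOneOne_rational_holds A p

/-- **The divisor-generated sector of the crux, unconditionally** ("if `Dᵖ = Bᵖ`, then the Hodge
`(p,p)`-conjecture is true for `X`", van Geemen §2.4; Mattuck: the general abelian variety; Tate,
Imai, Murasaki: products of elliptic curves; Tankeev, Ribet: simple of prime dimension): an abelian
variety all of whose rational `(p,p)`-classes are `ℂ`-combinations of `p`-fold products of rational
`(1,1)`-classes satisfies the Hodge conjecture — the registered partial
`hodgeConjectureFor_of_divisorGenerated` with its antecedent `lefschetzOneOne_rational` DISCHARGED.
[cite: vanGeemen1994HodgeAV, §2.4, Thms. 4.2, 4.3 and 4.6] -/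
theorem hodgeConjectureFor_of_divisorGenerated_holds : ∀ A : AbelianVariety ℂ, (∀ (p : ℕ) (c : singularCohomology ℂ ℂ (ComplexPoints A.X) (2 * p)), IsRationalClass c → IsOfHodgeType A.dim A.X (2 * p) p p c → c ∈ Literature.Barriers.HodgeConjecture.divisorClassesSpan A.X A.dim p) → HodgeConjectureFor A.dim A.X :=
  Cruxes.HodgeAbelianVarieties.EStepSecantInduction.Stubs.WeilSector.hodgeConjectureFor_of_divisorGenerated
    lefschetzOneOne_rational_holds

/-- **Deep-middle form of the divisor-generated sector**: it suffices that the rational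
`(p,p)`-classes in the DEEP middle (`2 ≤ p`, `2p ≤ dim A`) of every abelian variety be spanned by
divisor monomials — the other codimensions are theorems (`hodgeAbelianVarieties_iff_deepMiddle_holds`).
This is the exact shape of the classical results `Bᵖ = Dᵖ` (which are proved degree by degree).
[cite: vanGeemen1994HodgeAV, §2.4] [cite: KerrPearlstein2011, §3.1] -/
theorem hodgeAbelianVarieties_of_deepMiddle_divisorGenerated
    (hD : ∀ (A : AbelianVariety ℂ) (p : ℕ), 2 ≤ p → 2 * p ≤ A.dim →
      ∀ c : singularCohomology ℂ ℂ (ComplexPoints A.X) (2 * p), IsRationalClass c →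
        IsOfHodgeType A.dim A.X (2 * p) p p c →
          c ∈ Literature.Barriers.HodgeConjecture.divisorClassesSpan A.X A.dim p) :
    HodgeAbelianVarieties :=
  hodgeAbelianVarieties_iff_deepMiddle_holds.2 fun A p hp hpd c hc hpp ↦
    divisorClassesSpan_le_algebraicClasses_holds A p (hD A p hp hpd c hc hpp)

end Summit.HodgeConjecture.HodgeConjecture.Theorems.HodgeAbelianVarieties.Unconditional

end
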